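import Literature.Analysis.FluidPDE.ClassicalSupStabilityExplicit
import Literature.Analysis.FluidPDE.BallRadialMoments
import Literature.Analysis.FunctionSpaces.GaussianSchwartz
import Mathlib.MeasureTheory.Integral.Gamma
import Mathlib.MeasureTheory.Constructions.HaarToSphere
import Mathlib.Analysis.Real.Pi.Bounds
import HarnessLib

/-!
# An explicit upper bound for the Oseen slice constant in `ℝ³`:
# `‖N_σ[a, b](x)‖ ≤ (16/√π) σ^{-1/2} ‖a‖_∞ ‖b‖_∞`, and the sup-norm stability / smoothing cores
# with the constant `9.03`

Analysis/FluidPDE proof file (theorems only; no definitions, no named facts, no `sorry`). The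
slice operator `N_σ[a,b](x) = ∫ K(σ, x−y)[a(y), b(y)] dy` of the Oseen–Koch–Tataru kernel
(`oseenSlice`, `OseenSlice.lean`; KNSS 2009 §3 (3.5)) is bounded in the tree by
`‖N_σ[a,b](x)‖ ≤ C₀ σ^{-1/2} M_a M_b` with `C₀ = oseenSliceConst ℝ³` chosen by `Classical.choose`
(no upper bound provable) and, since `ClassicalSupStabilityExplicit.lean`, by the crude explicit
`8829` (through the `oseenHeat` realisation). This file proves the sharp-order explicit bound

  `‖N_σ[a, b](x)‖ ≤ (16/√π) σ^{-1/2} M_a M_b ≤ 9.03 σ^{-1/2} M_a M_b`   (`σ > 0`, any bounded `a, b`)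

directly from the kernel: by `norm_oseenKernel_le` (`KochTataru.lean`),
`‖K(τ,z)[a,b]‖ ≤ (‖z‖ G_τ(z)/(2τ) + 3 A(τ,z)‖z‖ + B(τ,z)‖z‖³) ‖a‖ ‖b‖` with the Gaussian weights
`A = ∫_τ^∞ G_s/(4s²) ds`, `B = ∫_τ^∞ G_s/(8s³) ds`, and the `L¹` norm of this envelope is computed in
closed form from the radial Gaussian moments in `ℝ³`,

  `∫ ‖z‖ G_s = 4√s/√π`,  `∫ ‖z‖³ G_s = 32 s√s/√π`  (polar coordinates + Gamma integrals),

and Fubini over `(τ, ∞) × ℝ³`: `∫ ‖z‖G_τ/(2τ) = 2/√(πτ)`, `∫ A‖z‖ = 2/√(πτ)`, `∫ B‖z‖³ = 8/√(πτ)`,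
total `(2 + 3·2 + 8)/√(πτ) = 16/√(πτ)` (`integral_oseenKernel_envelope_three`). The termwise
Cauchy–Schwarz in `norm_oseenKernel_le` loses the tensor structure, so `16/√π ≈ 9.027` is not the
optimal constant (the tree's lower bound is `(√π)⁻¹ ≈ 0.564`, `inv_sqrt_pi_le_oseenSliceConst`), but
it is of the right order — three orders of magnitude below `8829`.

The last section instantiates the parametric cores of `ClassicalSupStabilityExplicit.lean` at
`C = 9.03`: `sup_stability_forced_core_sharp` (Gronwall fee `exp (36 · 9.03² (M+M')² t/ν)`),
`sup_stability_forced_free_sharp`, `sup_stability_forced_smoothing_core_sharp` (shortness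
`(24 · 9.03 (M+M'))² T ≤ ν`, i.e. `T ≤ ν / (216.72 (M+M'))²`) and
`sup_stability_forced_smoothing_free_window_sharp`.

Consumer: the cell `ns-blowup` (route `PalasekTowerBreakdown`, crux `EpisodeBase`,
stmt-NavierStokesRegularity-19179), certificate road (ii′): the admissible smoothing window grows
from `ν/(4.5·10¹⁰ (M+M')²)` (with `8829`) to `ν/(4.7·10⁴ (M+M')²)`, and the smoothing factor
`(νh)^{-3/4}` drops by `≈ e^{10}`. LABEL: Literature port (harmonic analysis of the Stokes
semigroup kernel; a-priori estimates for GIVEN solutions). WHAT THIS IS NOT: not a statement about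
Navier–Stokes regularity or blow-up.

## Mathlib / tree search

Tree: `oseenKernel`, `oseenWeightA/B`, `norm_oseenKernel_le` (`KochTataru`);
`exists_oseenWeightA_le`, `exists_oseenWeightB_le` (nonnegativity), `measurable_heatKernel_uncurry`
(`KochTataruKernel`); `oseenSlice_apply` (`OseenSlice`);
`FunctionSpaces.integrable_pow_mul_norm_iteratedFDeriv_heatKernel` (`GaussianSchwartz`);
`volume_real_ball_zero_one_fin_three` (`BallRadialMoments`); the parametric cores
`sup_stability_forced_core_of_sliceBound`, `sup_stability_forced_smoothing_core_of_sliceBound`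
(`ClassicalSupStabilityExplicit`). Mathlib: `MeasureTheory.integral_fun_norm_addHaar`,
`integral_rpow_mul_exp_neg_mul_rpow`, `integral_Ioi_rpow_of_lt`, `integrableOn_Ioi_rpow_of_lt`,
`integrable_prod_iff`, `Integrable.swap`, `integral_integral_swap`, `Integrable.integral_prod_left`,
`integral_sub_left_eq_self`, `Real.pi_gt_d2`. `lean search 'oseenSliceConst|norm_oseenSlice_le'`:
lower bounds (`OseenSliceConstLowerBound`, `OseenSliceConstantLowerBound`) and the crude `8829` only.

## References

* G. Koch, N. Nadirashvili, G. Seregin, V. Šverák, Acta Math. 203 (2009), §3 (3.3)–(3.5), §4 p. 8.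
  [KochNadirashviliSereginSverak2009]
* H. Koch, D. Tataru, Adv. Math. 157 (2001), §2 (6)–(8), §3 (14). [KochTataruAdvMath2001]
* G. B. Folland, *Real Analysis*, 2nd ed. (1999), Thm. 2.49 (polar coordinates). [Folland1999]
* J. Leray, Acta Math. 63 (1934), §19 (3.4)–(3.8). [Leray1934]
* W. S. Ożański, B. C. Pooley, LMS Lecture Note Ser. 452 (2018), (6.65), Lemma 6.5. [OzanskiPooley2018]
* P. G. Lemarié-Rieusset, *The Navier–Stokes Problem in the 21st Century* (2016), Thm. 6.1. [LemarieRieusset2016]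
-/

noncomputable section

open MeasureTheory Set Function Filter Real
open _root_.Topology
open scoped ENNReal NNReal RealInnerProductSpace

namespace Literature.Analysis.FluidPDE

/-! ### Gaussian radial moments in `ℝ³` -/

section Moments

/-- **Radial Gaussian moments in `ℝ³`**: for `s > 0` and `k : ℕ`,
`∫ ‖z‖ᵏ G_s(z) dz = (4πs)^{-3/2} · 4π · ((1/(4s))^{-(k+3)/2} · ½ · Γ((k+3)/2))`
(polar coordinates, Mathlib's `integral_fun_norm_addHaar`, and the Gamma integral
`∫₀^∞ y^q e^{-b y²} dy = b^{-(q+1)/2} Γ((q+1)/2)/2`). [cite: Folland1999, Thm. 2.49] -/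
theorem integral_norm_pow_mul_heatKernel_three {s : ℝ} (hs : 0 < s) (k : ℕ) :
    ∫ z : EuclideanSpace ℝ (Fin 3), ‖z‖ ^ k * UnboundedOperators.heatKernel s z =
      (4 * π * s) ^ (-(3 : ℝ) / 2) * (4 * π) *
        ((1 / (4 * s)) ^ (-((k : ℝ) + 2 + 1) / 2) * (1 / 2) * Real.Gamma (((k : ℝ) + 2 + 1) / 2)) := by
  have hE : Module.finrank ℝ (EuclideanSpace ℝ (Fin 3)) = 3 := finrank_euclideanSpace_fin
  have hb : 0 < 1 / (4 * s) := by positivity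
  -- unfold the kernel and pull the normalisation out
  have hker : ∀ z : EuclideanSpace ℝ (Fin 3), ‖z‖ ^ k * UnboundedOperators.heatKernel s z =
      (4 * π * s) ^ (-(3 : ℝ) / 2) * (‖z‖ ^ k * Real.exp (-(1 / (4 * s)) * ‖z‖ ^ 2)) := by
    intro z
    rw [UnboundedOperators.heatKernel, hE]
    have : -‖z‖ ^ 2 / (4 * s) = -(1 / (4 * s)) * ‖z‖ ^ 2 := by ring
    rw [this]
    push_cast
    ring
  -- the radial integral is a Gamma integral
  have hinner : ∫ y in Ioi (0 : ℝ), y ^ (3 - 1) • (y ^ k * Real.exp (-(1 / (4 * s)) * y ^ 2)) =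
      ∫ y in Ioi (0 : ℝ), y ^ ((k : ℝ) + 2) * Real.exp (-(1 / (4 * s)) * y ^ (2 : ℝ)) := by
    refine setIntegral_congr_fun measurableSet_Ioi fun y hy => ?_
    simp only [smul_eq_mul]
    rw [show ((k : ℝ) + 2) = ((k + 2 : ℕ) : ℝ) by push_cast; ring, Real.rpow_natCast,
      show (2 : ℝ) = ((2 : ℕ) : ℝ) by norm_num, Real.rpow_natCast]
    ring
  -- polar coordinates
  have hrad : ∫ z : EuclideanSpace ℝ (Fin 3), ‖z‖ ^ k * Real.exp (-(1 / (4 * s)) * ‖z‖ ^ 2) =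
      (3 : ℕ) • (4 * π / 3) • ∫ y in Ioi (0 : ℝ), y ^ (3 - 1) • (y ^ k * Real.exp (-(1 / (4 * s)) * y ^ 2)) := by
    have h := MeasureTheory.integral_fun_norm_addHaar (volume : Measure (EuclideanSpace ℝ (Fin 3)))
      (fun y : ℝ => y ^ k * Real.exp (-(1 / (4 * s)) * y ^ 2))
    rw [hE, measureReal_def, volume_real_ball_zero_one_fin_three] at h
    exact h
  simp_rw [hker]
  rw [integral_const_mul, hrad, hinner,
    integral_rpow_mul_exp_neg_mul_rpow (by norm_num : (0 : ℝ) < 2)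
      (by have := (Nat.cast_nonneg k : (0 : ℝ) ≤ k); linarith) hb,
    nsmul_eq_mul, smul_eq_mul]
  push_cast
  ring

/-- **First radial Gaussian moment in `ℝ³`**: `∫ ‖z‖ G_s(z) dz = 4 √s / √π` (`s > 0`).
[cite: Folland1999, Thm. 2.49] -/
theorem integral_norm_mul_heatKernel_three {s : ℝ} (hs : 0 < s) :
    ∫ z : EuclideanSpace ℝ (Fin 3), ‖z‖ * UnboundedOperators.heatKernel s z =
      4 * Real.sqrt s / Real.sqrt π := by
  have h := integral_norm_pow_mul_heatKernel_three hs 1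
  simp only [pow_one] at h
  rw [h]
  have hπ : 0 < π := Real.pi_pos
  -- `(1/(4s))^{-2} · ½ · Γ(2) = 8 s²`
  have hG : Real.Gamma ((((1 : ℕ) : ℝ) + 2 + 1) / 2) = 1 := by norm_num [Real.Gamma_two]
  have hpow : (1 / (4 * s)) ^ (-(((1 : ℕ) : ℝ) + 2 + 1) / 2) = (4 * s) ^ (2 : ℝ) := by
    rw [show (-(((1 : ℕ) : ℝ) + 2 + 1) / 2) = -(2 : ℝ) by norm_num, one_div,
      Real.inv_rpow (by positivity), ← Real.rpow_neg (by positivity), neg_neg]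
  rw [hG, hpow, show ((4 : ℝ) * s) ^ (2 : ℝ) = (4 * s) ^ 2 by
    rw [show (2 : ℝ) = ((2 : ℕ) : ℝ) by norm_num, Real.rpow_natCast]]
  -- `(4πs)^{-3/2} = ((4πs) √(4πs))⁻¹`
  have h4πs : 0 < 4 * π * s := by positivity
  have hrpow : (4 * π * s) ^ (-(3 : ℝ) / 2) = ((4 * π * s) * Real.sqrt (4 * π * s))⁻¹ := by
    rw [show (-(3 : ℝ) / 2) = -((1 : ℝ) + 1 / 2) by norm_num, Real.rpow_neg h4πs.le,
      Real.rpow_add h4πs, Real.rpow_one, Real.sqrt_eq_rpow]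
  rw [hrpow]
  have hsq : Real.sqrt (4 * π * s) = 2 * Real.sqrt π * Real.sqrt s := by
    rw [Real.sqrt_mul (by positivity), Real.sqrt_mul (by norm_num),
      show Real.sqrt 4 = 2 by rw [show (4 : ℝ) = 2 ^ 2 by norm_num, Real.sqrt_sq (by norm_num)]]
  rw [hsq]
  have hsπ : 0 < Real.sqrt π := Real.sqrt_pos.2 hπ
  have hss : 0 < Real.sqrt s := Real.sqrt_pos.2 hs
  have hs2 : Real.sqrt s * Real.sqrt s = s := Real.mul_self_sqrt hs.le
  field_simp
  nlinarith [hs2, hsπ, hss]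

/-- **Third radial Gaussian moment in `ℝ³`**: `∫ ‖z‖³ G_s(z) dz = 32 s √s / √π` (`s > 0`).
[cite: Folland1999, Thm. 2.49] -/
theorem integral_norm_pow_three_mul_heatKernel_three {s : ℝ} (hs : 0 < s) :
    ∫ z : EuclideanSpace ℝ (Fin 3), ‖z‖ ^ 3 * UnboundedOperators.heatKernel s z =
      32 * s * Real.sqrt s / Real.sqrt π := by
  have h := integral_norm_pow_mul_heatKernel_three hs 3
  rw [h]
  have hπ : 0 < π := Real.pi_pos
  -- `(1/(4s))^{-3} · ½ · Γ(3) = 64 s³`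
  have hG : Real.Gamma ((((3 : ℕ) : ℝ) + 2 + 1) / 2) = 2 := by
    rw [show ((((3 : ℕ) : ℝ) + 2 + 1) / 2) = (2 : ℝ) + 1 by norm_num, Real.Gamma_add_one (by norm_num),
      Real.Gamma_two]
    norm_num
  have hpow : (1 / (4 * s)) ^ (-(((3 : ℕ) : ℝ) + 2 + 1) / 2) = (4 * s) ^ (3 : ℝ) := by
    rw [show (-(((3 : ℕ) : ℝ) + 2 + 1) / 2) = -(3 : ℝ) by norm_num, one_div,
      Real.inv_rpow (by positivity), ← Real.rpow_neg (by positivity), neg_neg]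
  rw [hG, hpow, show ((4 : ℝ) * s) ^ (3 : ℝ) = (4 * s) ^ 3 by
    rw [show (3 : ℝ) = ((3 : ℕ) : ℝ) by norm_num, Real.rpow_natCast]]
  have h4πs : 0 < 4 * π * s := by positivity
  have hrpow : (4 * π * s) ^ (-(3 : ℝ) / 2) = ((4 * π * s) * Real.sqrt (4 * π * s))⁻¹ := by
    rw [show (-(3 : ℝ) / 2) = -((1 : ℝ) + 1 / 2) by norm_num, Real.rpow_neg h4πs.le,
      Real.rpow_add h4πs, Real.rpow_one, Real.sqrt_eq_rpow]
  rw [hrpow]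
  have hsq : Real.sqrt (4 * π * s) = 2 * Real.sqrt π * Real.sqrt s := by
    rw [Real.sqrt_mul (by positivity), Real.sqrt_mul (by norm_num),
      show Real.sqrt 4 = 2 by rw [show (4 : ℝ) = 2 ^ 2 by norm_num, Real.sqrt_sq (by norm_num)]]
  rw [hsq]
  have hsπ : 0 < Real.sqrt π := Real.sqrt_pos.2 hπ
  have hss : 0 < Real.sqrt s := Real.sqrt_pos.2 hs
  have hs2 : Real.sqrt s * Real.sqrt s = s := Real.mul_self_sqrt hs.le
  field_simp
  nlinarith [hs2, hsπ, hss]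

end Moments

/-- Integrability of the radial Gaussian moments `‖z‖ᵏ G_s(z)` (`s > 0`; Schwartz decay).
[folklore] -/
private theorem integrable_norm_pow_mul_heatKernel {s : ℝ} (hs : 0 < s) (k : ℕ) :
    Integrable (fun z : EuclideanSpace ℝ (Fin 3) => ‖z‖ ^ k * UnboundedOperators.heatKernel s z) := by
  have h := FunctionSpaces.integrable_pow_mul_norm_iteratedFDeriv_heatKernel
    (E := EuclideanSpace ℝ (Fin 3)) hs k 0
  refine h.congr (Eventually.of_forall fun z => ?_)
  simp only [norm_iteratedFDeriv_zero, Real.norm_of_nonneg (UnboundedOperators.heatKernel_pos hs z).le]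

/-! ### The weighted moments of the Gaussian weights `A`, `B` (Fubini over `(τ, ∞) × ℝ³`) -/

section Weights

/-- **Fubini for a half-line Gaussian moment**: for `τ > 0`, `c > 0`, `n, k : ℕ`, if the radial
moment `s ↦ (∫ ‖z‖ᵏ G_s) / (c sⁿ)` coincides on `(τ, ∞)` with an integrable function `g`, then the
integrand `(s, z) ↦ G_s(z) ‖z‖ᵏ / (c sⁿ)` is integrable on `(τ, ∞) × ℝ³` and
`∫ (∫_{s>τ} G_s(z)/(c sⁿ) ds) ‖z‖ᵏ dz = ∫_{s>τ} g(s) ds`. [folklore] -/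
private theorem integral_setIntegral_heatKernel_div_mul_norm_pow {τ c : ℝ} (hτ : 0 < τ) (hc : 0 < c)
    (n k : ℕ) {g : ℝ → ℝ}
    (hg : ∀ s ∈ Ioi τ, (∫ z : EuclideanSpace ℝ (Fin 3), ‖z‖ ^ k * UnboundedOperators.heatKernel s z) /
      (c * s ^ n) = g s)
    (hgi : IntegrableOn g (Ioi τ)) :
    Integrable (fun z : EuclideanSpace ℝ (Fin 3) =>
        (∫ s in Ioi τ, UnboundedOperators.heatKernel s z / (c * s ^ n)) * ‖z‖ ^ k) ∧
      ∫ z : EuclideanSpace ℝ (Fin 3),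
          (∫ s in Ioi τ, UnboundedOperators.heatKernel s z / (c * s ^ n)) * ‖z‖ ^ k =
        ∫ s in Ioi τ, g s := by
  -- the joint integrand, in the order `(s, z)`
  set F : ℝ → EuclideanSpace ℝ (Fin 3) → ℝ := fun s z =>
    UnboundedOperators.heatKernel s z / (c * s ^ n) * ‖z‖ ^ k with hF
  have hFm : Measurable (uncurry F) := by
    have h1 : Measurable (fun q : ℝ × EuclideanSpace ℝ (Fin 3) =>
        UnboundedOperators.heatKernel q.1 q.2) := measurable_heatKernel_uncurry
    exact (h1.div (measurable_const.mul (measurable_fst.pow_const n))).mul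
      (measurable_snd.norm.pow_const k)
  have hFnn : ∀ s ∈ Ioi τ, ∀ z, 0 ≤ F s z := fun s hs z =>
    mul_nonneg (div_nonneg (UnboundedOperators.heatKernel_pos (hτ.trans hs) z).le
      (mul_nonneg hc.le (pow_nonneg (hτ.trans hs).le _))) (pow_nonneg (norm_nonneg _) _)
  -- slices in `z`
  have hslice : ∀ s ∈ Ioi τ, Integrable (F s) ∧
      ∫ z, F s z = g s := by
    intro s hs
    have hs0 : 0 < s := hτ.trans hs
    have heq : F s = fun z => (c * s ^ n)⁻¹ * (‖z‖ ^ k * UnboundedOperators.heatKernel s z) := by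
      funext z; simp only [hF]; ring
    refine ⟨?_, ?_⟩
    · rw [heq]; exact (integrable_norm_pow_mul_heatKernel hs0 k).const_mul _
    · rw [heq, integral_const_mul, ← hg s hs]; ring
  -- integrability on the product `(τ, ∞) × ℝ³`
  have hprod : Integrable (uncurry F) ((volume.restrict (Ioi τ)).prod volume) := by
    rw [integrable_prod_iff hFm.aestronglyMeasurable]
    refine ⟨(ae_restrict_iff' measurableSet_Ioi).2 (Eventually.of_forall fun s hs => (hslice s hs).1), ?_⟩
    refine hgi.congr_fun (fun s hs => ?_) measurableSet_Ioi |>.integrable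
    rw [← (hslice s hs).2]
    refine integral_congr_ae (Eventually.of_forall fun z => ?_)
    show F s z = ‖F s z‖
    rw [Real.norm_of_nonneg (hFnn s hs z)]
  -- swap
  have hswap : Integrable (uncurry fun z s => F s z) (volume.prod (volume.restrict (Ioi τ))) :=
    hprod.swap
  have hmul : ∀ z : EuclideanSpace ℝ (Fin 3),
      (∫ s in Ioi τ, UnboundedOperators.heatKernel s z / (c * s ^ n)) * ‖z‖ ^ k =
        ∫ s in Ioi τ, F s z := by
    intro z
    rw [← integral_mul_const]
  refine ⟨?_, ?_⟩
  · have h := hswap.integral_prod_left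
    refine h.congr (Eventually.of_forall fun z => ?_)
    simp only [uncurry, hmul]
  · simp_rw [hmul]
    rw [integral_integral_swap hswap]
    exact setIntegral_congr_fun measurableSet_Ioi fun s hs => (hslice s hs).2

/-- **The weighted moment of the first Gaussian weight**: for `τ > 0`,
`z ↦ A(τ, z) ‖z‖` is integrable on `ℝ³` and `∫ A(τ, z) ‖z‖ dz = 2 / (√π √τ)`
(`A = ∫_τ^∞ G_s/(4s²) ds`; Fubini and `∫ ‖z‖ G_s = 4√s/√π`). [cite: KochTataruAdvMath2001, §2 (6)–(8)] -/
theorem integral_oseenWeightA_mul_norm_three {τ : ℝ} (hτ : 0 < τ) :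
    Integrable (fun z : EuclideanSpace ℝ (Fin 3) => oseenWeightA τ z * ‖z‖) ∧
      ∫ z : EuclideanSpace ℝ (Fin 3), oseenWeightA τ z * ‖z‖ = 2 / (Real.sqrt π * Real.sqrt τ) := by
  have hsπ : 0 < Real.sqrt π := Real.sqrt_pos.2 Real.pi_pos
  -- the radial moment divided by `4 s²` is `s^{-3/2}/√π`
  have hg : ∀ s ∈ Ioi τ, (∫ z : EuclideanSpace ℝ (Fin 3), ‖z‖ ^ 1 * UnboundedOperators.heatKernel s z) /
      (4 * s ^ 2) = (Real.sqrt π)⁻¹ * s ^ (-(3 : ℝ) / 2) := by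
    intro s hs
    have hs0 : 0 < s := hτ.trans hs
    simp only [pow_one]
    rw [integral_norm_mul_heatKernel_three hs0]
    have hss : 0 < Real.sqrt s := Real.sqrt_pos.2 hs0
    have hs2 : Real.sqrt s * Real.sqrt s = s := Real.mul_self_sqrt hs0.le
    have hrpow : s ^ (-(3 : ℝ) / 2) = (s * Real.sqrt s)⁻¹ := by
      rw [show (-(3 : ℝ) / 2) = -((1 : ℝ) + 1 / 2) by norm_num, Real.rpow_neg hs0.le,
        Real.rpow_add hs0, Real.rpow_one, Real.sqrt_eq_rpow]
    rw [hrpow]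
    field_simp
    nlinarith [hs2, hss]
  have hgi : IntegrableOn (fun s : ℝ => (Real.sqrt π)⁻¹ * s ^ (-(3 : ℝ) / 2)) (Ioi τ) :=
    (integrableOn_Ioi_rpow_of_lt (by norm_num) hτ).const_mul _
  obtain ⟨hint, hval⟩ := integral_setIntegral_heatKernel_div_mul_norm_pow hτ (by norm_num : (0:ℝ) < 4)
    2 1 hg hgi
  simp only [pow_one] at hint hval
  refine ⟨hint, ?_⟩
  rw [show (fun z : EuclideanSpace ℝ (Fin 3) => oseenWeightA τ z * ‖z‖) =
      fun z => (∫ s in Ioi τ, UnboundedOperators.heatKernel s z / (4 * s ^ 2)) * ‖z‖ from rfl] at *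
  rw [hval, integral_const_mul, integral_Ioi_rpow_of_lt (by norm_num) hτ]
  have hsτ : 0 < Real.sqrt τ := Real.sqrt_pos.2 hτ
  have hrpow : τ ^ (-(3 : ℝ) / 2 + 1) = (Real.sqrt τ)⁻¹ := by
    rw [show (-(3 : ℝ) / 2 + 1) = -(1 / 2 : ℝ) by norm_num, Real.rpow_neg hτ.le, Real.sqrt_eq_rpow]
  rw [hrpow]
  field_simp
  ring

/-- **The weighted moment of the second Gaussian weight**: for `τ > 0`,
`z ↦ B(τ, z) ‖z‖³` is integrable on `ℝ³` and `∫ B(τ, z) ‖z‖³ dz = 8 / (√π √τ)`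
(`B = ∫_τ^∞ G_s/(8s³) ds`; Fubini and `∫ ‖z‖³ G_s = 32 s√s/√π`). [cite: KochTataruAdvMath2001, §2 (6)–(8)] -/
theorem integral_oseenWeightB_mul_norm_pow_three {τ : ℝ} (hτ : 0 < τ) :
    Integrable (fun z : EuclideanSpace ℝ (Fin 3) => oseenWeightB τ z * ‖z‖ ^ 3) ∧
      ∫ z : EuclideanSpace ℝ (Fin 3), oseenWeightB τ z * ‖z‖ ^ 3 = 8 / (Real.sqrt π * Real.sqrt τ) := by
  have hsπ : 0 < Real.sqrt π := Real.sqrt_pos.2 Real.pi_pos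
  have hg : ∀ s ∈ Ioi τ, (∫ z : EuclideanSpace ℝ (Fin 3), ‖z‖ ^ 3 * UnboundedOperators.heatKernel s z) /
      (8 * s ^ 3) = 4 * (Real.sqrt π)⁻¹ * s ^ (-(3 : ℝ) / 2) := by
    intro s hs
    have hs0 : 0 < s := hτ.trans hs
    rw [integral_norm_pow_three_mul_heatKernel_three hs0]
    have hss : 0 < Real.sqrt s := Real.sqrt_pos.2 hs0
    have hs2 : Real.sqrt s * Real.sqrt s = s := Real.mul_self_sqrt hs0.le
    have hrpow : s ^ (-(3 : ℝ) / 2) = (s * Real.sqrt s)⁻¹ := by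
      rw [show (-(3 : ℝ) / 2) = -((1 : ℝ) + 1 / 2) by norm_num, Real.rpow_neg hs0.le,
        Real.rpow_add hs0, Real.rpow_one, Real.sqrt_eq_rpow]
    rw [hrpow]
    field_simp
    nlinarith [hs2, hss]
  have hgi : IntegrableOn (fun s : ℝ => 4 * (Real.sqrt π)⁻¹ * s ^ (-(3 : ℝ) / 2)) (Ioi τ) :=
    (integrableOn_Ioi_rpow_of_lt (by norm_num) hτ).const_mul _
  obtain ⟨hint, hval⟩ := integral_setIntegral_heatKernel_div_mul_norm_pow hτ (by norm_num : (0:ℝ) < 8)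
    3 3 hg hgi
  refine ⟨hint, ?_⟩
  rw [show (fun z : EuclideanSpace ℝ (Fin 3) => oseenWeightB τ z * ‖z‖ ^ 3) =
      fun z => (∫ s in Ioi τ, UnboundedOperators.heatKernel s z / (8 * s ^ 3)) * ‖z‖ ^ 3 from rfl]
  rw [hval, integral_const_mul, integral_Ioi_rpow_of_lt (by norm_num) hτ]
  have hsτ : 0 < Real.sqrt τ := Real.sqrt_pos.2 hτ
  have hrpow : τ ^ (-(3 : ℝ) / 2 + 1) = (Real.sqrt τ)⁻¹ := by
    rw [show (-(3 : ℝ) / 2 + 1) = -(1 / 2 : ℝ) by norm_num, Real.rpow_neg hτ.le, Real.sqrt_eq_rpow]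
  rw [hrpow]
  field_simp
  ring

end Weights

/-! ### The explicit slice bound -/

section Slice

/-- **The `L¹` norm of the envelope of the Oseen–Koch–Tataru kernel in `ℝ³`**: for `τ > 0`, the
envelope `M(τ, z) = ‖z‖ G_τ(z)/(2τ) + 3 A(τ,z) ‖z‖ + B(τ,z) ‖z‖³` of `norm_oseenKernel_le` is
integrable and `∫ M(τ, z) dz = 16 / (√π √τ)` (`= 2/√(πτ) + 6/√(πτ) + 8/√(πτ)`).
[cite: KochTataruAdvMath2001, §3 (14)] -/
theorem integral_oseenKernel_envelope_three {τ : ℝ} (hτ : 0 < τ) :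
    Integrable (fun z : EuclideanSpace ℝ (Fin 3) =>
        ‖z‖ * |UnboundedOperators.heatKernel τ z| / (2 * |τ|) + 3 * |oseenWeightA τ z| * ‖z‖ +
          |oseenWeightB τ z| * ‖z‖ ^ 3) ∧
      ∫ z : EuclideanSpace ℝ (Fin 3),
          (‖z‖ * |UnboundedOperators.heatKernel τ z| / (2 * |τ|) + 3 * |oseenWeightA τ z| * ‖z‖ +
            |oseenWeightB τ z| * ‖z‖ ^ 3) =
        16 / (Real.sqrt π * Real.sqrt τ) := by
  obtain ⟨_, _, hA⟩ := exists_oseenWeightA_le (E := EuclideanSpace ℝ (Fin 3))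
  obtain ⟨_, _, hB⟩ := exists_oseenWeightB_le (E := EuclideanSpace ℝ (Fin 3))
  have hA0 : ∀ z : EuclideanSpace ℝ (Fin 3), 0 ≤ oseenWeightA τ z := fun z => (hA hτ z).2.1
  have hB0 : ∀ z : EuclideanSpace ℝ (Fin 3), 0 ≤ oseenWeightB τ z := fun z => (hB hτ z).2.1
  obtain ⟨hAi, hAv⟩ := integral_oseenWeightA_mul_norm_three hτ
  obtain ⟨hBi, hBv⟩ := integral_oseenWeightB_mul_norm_pow_three hτ
  have h1i : Integrable (fun z : EuclideanSpace ℝ (Fin 3) => ‖z‖ * UnboundedOperators.heatKernel τ z) := by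
    simpa only [pow_one] using integrable_norm_pow_mul_heatKernel hτ 1
  have h1v : ∫ z : EuclideanSpace ℝ (Fin 3), ‖z‖ * UnboundedOperators.heatKernel τ z =
      4 * Real.sqrt τ / Real.sqrt π := integral_norm_mul_heatKernel_three hτ
  -- rewrite the envelope without absolute values
  have henv : (fun z : EuclideanSpace ℝ (Fin 3) =>
      ‖z‖ * |UnboundedOperators.heatKernel τ z| / (2 * |τ|) + 3 * |oseenWeightA τ z| * ‖z‖ +
        |oseenWeightB τ z| * ‖z‖ ^ 3) =
      fun z => (2 * τ)⁻¹ * (‖z‖ * UnboundedOperators.heatKernel τ z) + 3 * (oseenWeightA τ z * ‖z‖) +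
        oseenWeightB τ z * ‖z‖ ^ 3 := by
    funext z
    rw [abs_of_pos (UnboundedOperators.heatKernel_pos hτ z), abs_of_pos hτ, abs_of_nonneg (hA0 z),
      abs_of_nonneg (hB0 z)]
    ring
  rw [henv]
  have h1c : Integrable (fun z : EuclideanSpace ℝ (Fin 3) =>
      (2 * τ)⁻¹ * (‖z‖ * UnboundedOperators.heatKernel τ z)) := h1i.const_mul _
  have hAc : Integrable (fun z : EuclideanSpace ℝ (Fin 3) => 3 * (oseenWeightA τ z * ‖z‖)) :=
    hAi.const_mul _
  have h12 : Integrable (fun z : EuclideanSpace ℝ (Fin 3) =>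
      (2 * τ)⁻¹ * (‖z‖ * UnboundedOperators.heatKernel τ z) + 3 * (oseenWeightA τ z * ‖z‖)) :=
    h1c.add hAc
  refine ⟨h12.add hBi, ?_⟩
  rw [integral_add h12 hBi, integral_add h1c hAc, integral_const_mul, integral_const_mul,
    h1v, hAv, hBv]
  have hsπ : 0 < Real.sqrt π := Real.sqrt_pos.2 Real.pi_pos
  have hsτ : 0 < Real.sqrt τ := Real.sqrt_pos.2 hτ
  have hτ2 : Real.sqrt τ * Real.sqrt τ = τ := Real.mul_self_sqrt hτ.le
  field_simp
  nlinarith [hτ2, hsπ, hsτ]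

/-- **The explicit slice bound with the sharp-order constant `16/√π ≈ 9.03`**: for `σ > 0` and
fields bounded by `M_a`, `M_b` (no measurability needed),
`‖N_σ[a, b](x)‖ ≤ (16/√π) σ^{-1/2} M_a M_b` at every `x` — the `L¹` norm of the kernel envelope
(`integral_oseenKernel_envelope_three`) against `‖K(σ, x−y)[a y, b y]‖ ≤ M(σ, x−y) M_a M_b`
(`norm_oseenKernel_le`). [cite: KochNadirashviliSereginSverak2009, §3 (3.5) and §4 p. 8 (arXiv:0709.3599v1)] -/
theorem norm_oseenSlice_le_sixteen_div_sqrt_pi {σ : ℝ} (hσ : 0 < σ)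
    {a b : EuclideanSpace ℝ (Fin 3) → EuclideanSpace ℝ (Fin 3)} {Ma Mb : ℝ}
    (ha : ∀ y, ‖a y‖ ≤ Ma) (hb : ∀ y, ‖b y‖ ≤ Mb) (x : EuclideanSpace ℝ (Fin 3)) :
    ‖oseenSlice σ a b x‖ ≤ 16 / Real.sqrt π * σ ^ (-(1 / 2 : ℝ)) * Ma * Mb := by
  set M : EuclideanSpace ℝ (Fin 3) → ℝ := fun z =>
    ‖z‖ * |UnboundedOperators.heatKernel σ z| / (2 * |σ|) + 3 * |oseenWeightA σ z| * ‖z‖ +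
      |oseenWeightB σ z| * ‖z‖ ^ 3 with hM
  obtain ⟨hMi, hMv⟩ := integral_oseenKernel_envelope_three hσ
  have hMa : 0 ≤ Ma := (norm_nonneg _).trans (ha 0)
  have hMb : 0 ≤ Mb := (norm_nonneg _).trans (hb 0)
  have hM0 : ∀ z, 0 ≤ M z := fun z => by positivity
  -- the dominating function `y ↦ M(x − y) Ma Mb`
  have hdom : Integrable (fun y : EuclideanSpace ℝ (Fin 3) => M (x - y) * (Ma * Mb)) :=
    (hMi.comp_sub_left x).mul_const _
  rw [oseenSlice_apply]
  refine (norm_integral_le_of_norm_le hdom (Eventually.of_forall fun y => ?_)).trans ?_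
  · have h0 := hM0 (x - y)
    calc ‖oseenKernel σ (x - y) (a y) (b y)‖ ≤ M (x - y) * ‖a y‖ * ‖b y‖ :=
          norm_oseenKernel_le σ (x - y) (a y) (b y)
      _ ≤ M (x - y) * Ma * Mb :=
          mul_le_mul (mul_le_mul_of_nonneg_left (ha y) h0) (hb y) (norm_nonneg _) (mul_nonneg h0 hMa)
      _ = M (x - y) * (Ma * Mb) := by ring
  · rw [integral_mul_const, integral_sub_left_eq_self M volume x, hMv]
    have hsπ : 0 < Real.sqrt π := Real.sqrt_pos.2 Real.pi_pos
    have hsσ : 0 < Real.sqrt σ := Real.sqrt_pos.2 hσ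
    have hrpow : σ ^ (-(1 / 2 : ℝ)) = (Real.sqrt σ)⁻¹ := by
      rw [Real.rpow_neg hσ.le, Real.sqrt_eq_rpow]
    rw [hrpow]
    have : 16 / (Real.sqrt π * Real.sqrt σ) * (Ma * Mb) = 16 / Real.sqrt π * (Real.sqrt σ)⁻¹ * Ma * Mb := by
      field_simp
    rw [this]

/-- **Numerical form**: `16/√π < 9.03`, so `‖N_σ[a, b](x)‖ ≤ 9.03 σ^{-1/2} M_a M_b`.
[cite: KochNadirashviliSereginSverak2009, §3 (3.5) and §4 p. 8 (arXiv:0709.3599v1)] -/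
theorem norm_oseenSlice_le_explicit {σ : ℝ} (hσ : 0 < σ)
    {a b : EuclideanSpace ℝ (Fin 3) → EuclideanSpace ℝ (Fin 3)} {Ma Mb : ℝ}
    (ha : ∀ y, ‖a y‖ ≤ Ma) (hb : ∀ y, ‖b y‖ ≤ Mb) (x : EuclideanSpace ℝ (Fin 3)) :
    ‖oseenSlice σ a b x‖ ≤ 9.03 * σ ^ (-(1 / 2 : ℝ)) * Ma * Mb := by
  have hMa : 0 ≤ Ma := (norm_nonneg _).trans (ha 0)
  have hMb : 0 ≤ Mb := (norm_nonneg _).trans (hb 0)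
  refine (norm_oseenSlice_le_sixteen_div_sqrt_pi hσ ha hb x).trans ?_
  have hπ3 : (3.14 : ℝ) < π := Real.pi_gt_d2
  have hsπ : Real.sqrt 3.14 < Real.sqrt π := Real.sqrt_lt_sqrt (by norm_num) hπ3
  have h177 : (1.772 : ℝ) ≤ Real.sqrt 3.14 := by
    rw [show (1.772 : ℝ) = Real.sqrt (1.772 ^ 2) by rw [Real.sqrt_sq (by norm_num)]]
    exact Real.sqrt_le_sqrt (by norm_num)
  have hsπpos : 0 < Real.sqrt π := Real.sqrt_pos.2 Real.pi_pos
  have hc : 16 / Real.sqrt π ≤ 9.03 := by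
    rw [div_le_iff₀ hsπpos]; nlinarith
  have hσr : 0 ≤ σ ^ (-(1 / 2 : ℝ)) := Real.rpow_nonneg hσ.le _
  gcongr

end Slice

/-! ### The sup-norm stability and smoothing cores with the constant `9.03` -/

section Sharp

variable {ν T s M M' D E₀ Es F : ℝ}
  {g g' u u' : ℝ → EuclideanSpace ℝ (Fin 3) → EuclideanSpace ℝ (Fin 3)}
  {p p' : ℝ → EuclideanSpace ℝ (Fin 3) → ℝ} {G G' : ℝ} {G₂ G₂' : ℝ≥0∞}

/-- **Sup-norm stability with an SHARP-ORDER explicit fee**: under the hypotheses of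
`sup_stability_forced_core` (two bounded classical finite-energy forced solutions on `[0,T] × ℝ³`,
sup datum gap `≤ D`, force-Duhamel gap `≤ F`), for all `t ∈ [0, T]` and all `x`:
`‖u'(t,x) − u(t,x)‖ ≤ 2 (D + F) exp (36 · 9.03² (M + M')² t / ν)`.
[cite: Leray1934, §19 (3.4)–(3.8)] [cite: LemarieRieusset2016, Thm. 6.1 (6.12) with Prop. 6.5] -/
theorem sup_stability_forced_core_sharp (hν : 0 < ν) (hT : 0 < T)
    (hcl : IsClassicalNSSolutionOn (Icc 0 T) ν g u p)
    (hcl' : IsClassicalNSSolutionOn (Icc 0 T) ν g' u' p')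
    (hgc : Continuous (uncurry g)) (hg'c : Continuous (uncurry g'))
    (hG : ∀ τ ∈ Icc 0 T, ∀ y, ‖g τ y‖ ≤ G) (hG' : ∀ τ ∈ Icc 0 T, ∀ y, ‖g' τ y‖ ≤ G')
    (hgdiv : ∀ τ ∈ Icc 0 T, IsWeaklyDivFree (g τ)) (hg'div : ∀ τ ∈ Icc 0 T, IsWeaklyDivFree (g' τ))
    (hG₂ : G₂ ≠ ⊤) (hG₂' : G₂' ≠ ⊤)
    (hg2 : ∀ τ ∈ Icc 0 T, eLpNorm (g τ) 2 volume ≤ G₂)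
    (hg'2 : ∀ τ ∈ Icc 0 T, eLpNorm (g' τ) 2 volume ≤ G₂')
    (hE : ∃ C : ℝ≥0∞, C < ⊤ ∧ ∀ t ∈ Icc 0 T, ∫⁻ x, ‖u t x‖ₑ ^ 2 ≤ C)
    (hE' : ∃ C : ℝ≥0∞, C < ⊤ ∧ ∀ t ∈ Icc 0 T, ∫⁻ x, ‖u' t x‖ₑ ^ 2 ≤ C)
    (hM : 0 < M) (hM' : 0 < M')
    (hbd : ∀ t ∈ Icc 0 T, ∀ y, ‖u t y‖ ≤ M) (hbd' : ∀ t ∈ Icc 0 T, ∀ y, ‖u' t y‖ ≤ M')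
    (hD : ∀ y, ‖u' 0 y - u 0 y‖ ≤ D) (hF0 : 0 ≤ F)
    (hF : ∀ t ∈ Ioc 0 T, ∀ x, ‖forceDuhamel ν 0 g' t x - forceDuhamel ν 0 g t x‖ ≤ F) :
    ∀ t ∈ Icc 0 T, ∀ x, ‖u' t x - u t x‖ ≤
      2 * (D + F) * Real.exp (36 * (9.03 : ℝ) ^ 2 * (M + M') ^ 2 / ν * t) :=
  sup_stability_forced_core_of_sliceBound (by norm_num)
    (fun {σ} hσ {a} {b} {Ma} {Mb} _ _ ha hb x => norm_oseenSlice_le_explicit hσ ha hb x)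
    hν hT hcl hcl' hgc hg'c hG hG' hgdiv hg'div hG₂ hG₂' hg2 hg'2 hE hE' hM hM' hbd hbd' hD hF0 hF

/-- **Sup-norm stability of an UNFORCED bounded classical solution under a small force measured in
`L²`, SHARP-ORDER explicit fee** (the initial layer of a certificate argument: `u` an exact free run, `u'` a
pseudo-run driven by its defect `g'`, equal or `D`-close data): for all `t ∈ [0, T]` and all `x`,
`‖u'(t,x) − u(t,x)‖ ≤ 2 (D + 4 ν^{-3/4} T^{1/4} sup‖g'‖₂) exp (36 · 9.03² (M + M')² t / ν)`.
[cite: Leray1934, §19 (3.4)–(3.8)] [cite: LemarieRieusset2016, Thm. 6.1 (6.12) with Prop. 6.5] -/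
theorem sup_stability_forced_free_sharp (hν : 0 < ν) (hT : 0 < T)
    (hcl : IsClassicalNSSolutionOn (Icc 0 T) ν 0 u p)
    (hcl' : IsClassicalNSSolutionOn (Icc 0 T) ν g' u' p')
    (hg'c : Continuous (uncurry g'))
    (hG' : ∀ τ ∈ Icc 0 T, ∀ y, ‖g' τ y‖ ≤ G')
    (hg'div : ∀ τ ∈ Icc 0 T, IsWeaklyDivFree (g' τ)) {G₂r : ℝ} (hG₂r : 0 ≤ G₂r)
    (hg'2 : ∀ τ ∈ Icc 0 T, eLpNorm (g' τ) 2 volume ≤ ENNReal.ofReal G₂r)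
    (hE : ∃ C : ℝ≥0∞, C < ⊤ ∧ ∀ t ∈ Icc 0 T, ∫⁻ x, ‖u t x‖ₑ ^ 2 ≤ C)
    (hE' : ∃ C : ℝ≥0∞, C < ⊤ ∧ ∀ t ∈ Icc 0 T, ∫⁻ x, ‖u' t x‖ₑ ^ 2 ≤ C)
    (hM : 0 < M) (hM' : 0 < M')
    (hbd : ∀ t ∈ Icc 0 T, ∀ y, ‖u t y‖ ≤ M) (hbd' : ∀ t ∈ Icc 0 T, ∀ y, ‖u' t y‖ ≤ M')
    (hD : ∀ y, ‖u' 0 y - u 0 y‖ ≤ D) :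
    ∀ t ∈ Icc 0 T, ∀ x, ‖u' t x - u t x‖ ≤
      2 * (D + 4 * ν ^ (-(3 / 4 : ℝ)) * T ^ (1 / 4 : ℝ) * G₂r) *
        Real.exp (36 * (9.03 : ℝ) ^ 2 * (M + M') ^ 2 / ν * t) := by
  have hgc : Continuous (uncurry (0 : ℝ → EuclideanSpace ℝ (Fin 3) → EuclideanSpace ℝ (Fin 3))) :=
    continuous_const
  have hG : ∀ τ ∈ Icc 0 T, ∀ y,
      ‖(0 : ℝ → EuclideanSpace ℝ (Fin 3) → EuclideanSpace ℝ (Fin 3)) τ y‖ ≤ 0 := fun τ _ y => by simp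
  have hgdiv : ∀ τ ∈ Icc 0 T,
      IsWeaklyDivFree ((0 : ℝ → EuclideanSpace ℝ (Fin 3) → EuclideanSpace ℝ (Fin 3)) τ) :=
    fun τ _ θ _ => by simp
  have hg2 : ∀ τ ∈ Icc 0 T,
      eLpNorm ((0 : ℝ → EuclideanSpace ℝ (Fin 3) → EuclideanSpace ℝ (Fin 3)) τ) 2 volume ≤ (0 : ℝ≥0∞) :=
    fun τ _ => by simp
  have hg'slc : ∀ τ, Continuous (g' τ) := fun τ => hg'c.comp (continuous_const.prodMk continuous_id)
  have hg'mem : ∀ τ ∈ Icc 0 T, MemLp (g' τ) 2 volume := fun τ hτ =>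
    ⟨(hg'slc τ).aestronglyMeasurable, (hg'2 τ hτ).trans_lt ENNReal.ofReal_lt_top⟩
  have hD0 : 0 ≤ D := (norm_nonneg _).trans (hD 0)
  refine sup_stability_forced_core_sharp hν hT hcl hcl' hgc hg'c hG hG' hgdiv hg'div
    ENNReal.zero_ne_top ENNReal.ofReal_ne_top hg2 hg'2 hE hE' hM hM' hbd hbd' hD (by positivity) ?_
  intro t ht x
  have h0 : forceDuhamel ν 0 (0 : ℝ → EuclideanSpace ℝ (Fin 3) → EuclideanSpace ℝ (Fin 3)) t x = 0 := by
    rw [forceDuhamel_apply]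
    have hz : ∀ τ, UnboundedOperators.heatExtension
        ((0 : ℝ → EuclideanSpace ℝ (Fin 3) → EuclideanSpace ℝ (Fin 3)) τ) (ν * (t - τ)) x = 0 := by
      intro τ
      have : ((0 : ℝ → EuclideanSpace ℝ (Fin 3) → EuclideanSpace ℝ (Fin 3)) τ) =
          fun _ : EuclideanSpace ℝ (Fin 3) => (0 : EuclideanSpace ℝ (Fin 3)) := rfl
      rw [this, UnboundedOperators.heatExtension_zero_fun]; rfl
    simp_rw [hz, integral_zero]
  rw [h0, sub_zero]
  refine (norm_forceDuhamel_le_of_eLpNorm_two hν ht.1 hG₂r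
    (fun τ hτ => hg'mem τ ⟨hτ.1.le, hτ.2.le.trans ht.2⟩)
    (fun τ hτ => hg'2 τ ⟨hτ.1.le, hτ.2.le.trans ht.2⟩) x).trans ?_
  have ht4 : t ^ (1 / 4 : ℝ) ≤ T ^ (1 / 4 : ℝ) := Real.rpow_le_rpow ht.1.le ht.2 (by norm_num)
  have hν34 : 0 ≤ 4 * ν ^ (-(3 / 4 : ℝ)) := by positivity
  gcongr

/-- **`L² → L^∞` smoothing of the gap on a short slab, SHARP-ORDER explicit shortness**: under the hypotheses
of `sup_stability_forced_smoothing_core` with the shortness condition `(24 · 9.03 (M + M'))² T ≤ ν`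
(in place of the unexplicit `C₀`), for all `t ∈ (0, T]` and all `x`:
`‖u'(t,x) − u(t,x)‖ ≤ 2 (E₀ ν^{-3/4} + F T^{3/4}) t^{-3/4}`.
[cite: Leray1934, §19 (3.4)–(3.8)] [cite: OzanskiPooley2018, (6.65) p. 143 and Lemma 6.5] -/
theorem sup_stability_forced_smoothing_core_sharp (hν : 0 < ν) (hT : 0 < T)
    (hcl : IsClassicalNSSolutionOn (Icc 0 T) ν g u p)
    (hcl' : IsClassicalNSSolutionOn (Icc 0 T) ν g' u' p')
    (hgc : Continuous (uncurry g)) (hg'c : Continuous (uncurry g'))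
    (hG : ∀ τ ∈ Icc 0 T, ∀ y, ‖g τ y‖ ≤ G) (hG' : ∀ τ ∈ Icc 0 T, ∀ y, ‖g' τ y‖ ≤ G')
    (hgdiv : ∀ τ ∈ Icc 0 T, IsWeaklyDivFree (g τ)) (hg'div : ∀ τ ∈ Icc 0 T, IsWeaklyDivFree (g' τ))
    (hG₂ : G₂ ≠ ⊤) (hG₂' : G₂' ≠ ⊤)
    (hg2 : ∀ τ ∈ Icc 0 T, eLpNorm (g τ) 2 volume ≤ G₂)
    (hg'2 : ∀ τ ∈ Icc 0 T, eLpNorm (g' τ) 2 volume ≤ G₂')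
    (hE : ∃ C : ℝ≥0∞, C < ⊤ ∧ ∀ t ∈ Icc 0 T, ∫⁻ x, ‖u t x‖ₑ ^ 2 ≤ C)
    (hE' : ∃ C : ℝ≥0∞, C < ⊤ ∧ ∀ t ∈ Icc 0 T, ∫⁻ x, ‖u' t x‖ₑ ^ 2 ≤ C)
    (hM : 0 < M) (hM' : 0 < M')
    (hbd : ∀ t ∈ Icc 0 T, ∀ y, ‖u t y‖ ≤ M) (hbd' : ∀ t ∈ Icc 0 T, ∀ y, ‖u' t y‖ ≤ M')
    (hTs : (24 * (9.03 : ℝ) * (M + M')) ^ 2 * T ≤ ν)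
    (hE₀ : 0 ≤ E₀) (hE0 : eLpNorm (fun y => u' 0 y - u 0 y) 2 volume ≤ ENNReal.ofReal E₀)
    (hF0 : 0 ≤ F)
    (hF : ∀ t ∈ Ioc 0 T, ∀ x, ‖forceDuhamel ν 0 g' t x - forceDuhamel ν 0 g t x‖ ≤ F) :
    ∀ t ∈ Ioc 0 T, ∀ x, ‖u' t x - u t x‖ ≤
      2 * (E₀ * ν ^ (-(3 / 4 : ℝ)) + F * T ^ (3 / 4 : ℝ)) * t ^ (-(3 / 4 : ℝ)) :=
  sup_stability_forced_smoothing_core_of_sliceBound (by norm_num)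
    (fun {σ} hσ {a} {b} {Ma} {Mb} _ _ ha hb x => norm_oseenSlice_le_explicit hσ ha hb x)
    hν hT hcl hcl' hgc hg'c hG hG' hgdiv hg'div hG₂ hG₂' hg2 hg'2 hE hE' hM hM' hbd hbd' hTs hE₀ hE0
    hF0 hF

/-- **`L² → L^∞` smoothing on a SHORT TERMINAL WINDOW `[s, T]`, SHARP-ORDER explicit shortness** (the form a
certificate consumes): `(u, p)` unforced and `(u', p')` forced by `g'` (jointly continuous,
bounded, weakly divergence-free slices, `‖g'(τ)‖₂ ≤ G₂'`), both classical with finite energy on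
`[0, T] × ℝ³` and bounded by `M`, `M'`; `0 ≤ s < T` with `(24 · 9.03 (M + M'))² (T − s) ≤ ν`; if
`‖u'(s,·) − u(s,·)‖₂ ≤ E_s` then for all `t ∈ (s, T]` and all `x`:
`‖u'(t,x) − u(t,x)‖ ≤ 2 (E_s ν^{-3/4} + 4 ν^{-3/4} (T−s)^{1/4} G₂' · (T−s)^{3/4}) (t − s)^{-3/4}`.
[cite: Leray1934, §19 (3.4)–(3.8)] [cite: OzanskiPooley2018, (6.65) p. 143 and Lemma 6.5] -/
theorem sup_stability_forced_smoothing_free_window_sharp (hν : 0 < ν) (hs0 : 0 ≤ s) (hsT : s < T)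
    (hcl : IsClassicalNSSolutionOn (Icc 0 T) ν 0 u p)
    (hcl' : IsClassicalNSSolutionOn (Icc 0 T) ν g' u' p')
    (hg'c : Continuous (uncurry g'))
    (hG' : ∀ τ ∈ Icc 0 T, ∀ y, ‖g' τ y‖ ≤ G')
    (hg'div : ∀ τ ∈ Icc 0 T, IsWeaklyDivFree (g' τ)) {G₂r : ℝ} (hG₂r : 0 ≤ G₂r)
    (hg'2 : ∀ τ ∈ Icc 0 T, eLpNorm (g' τ) 2 volume ≤ ENNReal.ofReal G₂r)
    (hE : ∃ C : ℝ≥0∞, C < ⊤ ∧ ∀ t ∈ Icc 0 T, ∫⁻ x, ‖u t x‖ₑ ^ 2 ≤ C)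
    (hE' : ∃ C : ℝ≥0∞, C < ⊤ ∧ ∀ t ∈ Icc 0 T, ∫⁻ x, ‖u' t x‖ₑ ^ 2 ≤ C)
    (hM : 0 < M) (hM' : 0 < M')
    (hbd : ∀ t ∈ Icc 0 T, ∀ y, ‖u t y‖ ≤ M) (hbd' : ∀ t ∈ Icc 0 T, ∀ y, ‖u' t y‖ ≤ M')
    (hTs : (24 * (9.03 : ℝ) * (M + M')) ^ 2 * (T - s) ≤ ν)
    (hEs0 : 0 ≤ Es) (hEs : eLpNorm (fun y => u' s y - u s y) 2 volume ≤ ENNReal.ofReal Es) :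
    ∀ t ∈ Ioc s T, ∀ x, ‖u' t x - u t x‖ ≤
      2 * (Es * ν ^ (-(3 / 4 : ℝ)) +
          4 * ν ^ (-(3 / 4 : ℝ)) * (T - s) ^ (1 / 4 : ℝ) * G₂r * (T - s) ^ (3 / 4 : ℝ)) *
        (t - s) ^ (-(3 / 4 : ℝ)) := by
  have hTs' : 0 < T - s := sub_pos.2 hsT
  -- the translated solutions on `[0, T - s]`
  have hmem : ∀ τ ∈ Icc 0 (T - s), τ + s ∈ Icc 0 T := fun τ hτ =>
    ⟨by linarith [hτ.1], by linarith [hτ.2]⟩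
  have hUD : UniqueDiffOn ℝ (Icc 0 (T - s)) := uniqueDiffOn_Icc hTs'
  have hclT : IsClassicalNSSolutionOn (Icc 0 (T - s)) ν 0 (fun t => u (t + s)) (fun t => p (t + s)) :=
    (hcl.comp_add_right s).mono (fun t ht => hmem t ht) hUD
  have hclT' : IsClassicalNSSolutionOn (Icc 0 (T - s)) ν (fun t => g' (t + s)) (fun t => u' (t + s))
      (fun t => p' (t + s)) :=
    (hcl'.comp_add_right s).mono (fun t ht => hmem t ht) hUD
  have hg'cT : Continuous (uncurry fun t => g' (t + s)) :=
    hg'c.comp ((continuous_fst.add continuous_const).prodMk continuous_snd)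
  have hG'T : ∀ τ ∈ Icc 0 (T - s), ∀ y, ‖g' (τ + s) y‖ ≤ G' := fun τ hτ => hG' _ (hmem τ hτ)
  have hg'divT : ∀ τ ∈ Icc 0 (T - s), IsWeaklyDivFree (g' (τ + s)) := fun τ hτ =>
    hg'div _ (hmem τ hτ)
  have hg'2T : ∀ τ ∈ Icc 0 (T - s), eLpNorm (g' (τ + s)) 2 volume ≤ ENNReal.ofReal G₂r :=
    fun τ hτ => hg'2 _ (hmem τ hτ)
  have hET : ∃ C : ℝ≥0∞, C < ⊤ ∧ ∀ t ∈ Icc 0 (T - s), ∫⁻ x, ‖u (t + s) x‖ₑ ^ 2 ≤ C := by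
    obtain ⟨C, hC, h⟩ := hE
    exact ⟨C, hC, fun t ht => h _ (hmem t ht)⟩
  have hET' : ∃ C : ℝ≥0∞, C < ⊤ ∧ ∀ t ∈ Icc 0 (T - s), ∫⁻ x, ‖u' (t + s) x‖ₑ ^ 2 ≤ C := by
    obtain ⟨C, hC, h⟩ := hE'
    exact ⟨C, hC, fun t ht => h _ (hmem t ht)⟩
  have hbdT : ∀ t ∈ Icc 0 (T - s), ∀ y, ‖u (t + s) y‖ ≤ M := fun t ht => hbd _ (hmem t ht)
  have hbdT' : ∀ t ∈ Icc 0 (T - s), ∀ y, ‖u' (t + s) y‖ ≤ M' := fun t ht => hbd' _ (hmem t ht)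
  have hEsT : eLpNorm (fun y => u' (0 + s) y - u (0 + s) y) 2 volume ≤ ENNReal.ofReal Es := by
    simpa only [zero_add] using hEs
  -- the unforced/`L²`-forced plumbing (as in `sup_stability_forced_smoothing_free`)
  have hgc : Continuous (uncurry (0 : ℝ → EuclideanSpace ℝ (Fin 3) → EuclideanSpace ℝ (Fin 3))) :=
    continuous_const
  have hG : ∀ τ ∈ Icc 0 (T - s), ∀ y,
      ‖(0 : ℝ → EuclideanSpace ℝ (Fin 3) → EuclideanSpace ℝ (Fin 3)) τ y‖ ≤ 0 := fun τ _ y => by simp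
  have hgdiv : ∀ τ ∈ Icc 0 (T - s),
      IsWeaklyDivFree ((0 : ℝ → EuclideanSpace ℝ (Fin 3) → EuclideanSpace ℝ (Fin 3)) τ) :=
    fun τ _ θ _ => by simp
  have hg2 : ∀ τ ∈ Icc 0 (T - s),
      eLpNorm ((0 : ℝ → EuclideanSpace ℝ (Fin 3) → EuclideanSpace ℝ (Fin 3)) τ) 2 volume ≤ (0 : ℝ≥0∞) :=
    fun τ _ => by simp
  have hg'slcT : ∀ τ, Continuous (g' (τ + s)) := fun τ =>
    hg'c.comp (continuous_const.prodMk continuous_id)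
  have hg'memT : ∀ τ ∈ Icc 0 (T - s), MemLp (g' (τ + s)) 2 volume := fun τ hτ =>
    ⟨(hg'slcT τ).aestronglyMeasurable, (hg'2T τ hτ).trans_lt ENNReal.ofReal_lt_top⟩
  have h := sup_stability_forced_smoothing_core_sharp hν hTs' hclT hclT' hgc hg'cT hG hG'T hgdiv
    hg'divT ENNReal.zero_ne_top ENNReal.ofReal_ne_top hg2 hg'2T hET hET' hM hM' hbdT hbdT' hTs hEs0 hEsT
    (F := 4 * ν ^ (-(3 / 4 : ℝ)) * (T - s) ^ (1 / 4 : ℝ) * G₂r) (by positivity) ?_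
  · intro t ht x
    have htI : t - s ∈ Ioc 0 (T - s) := ⟨sub_pos.2 ht.1, by linarith [ht.2]⟩
    have h' := h (t - s) htI x
    simpa only [sub_add_cancel] using h'
  · intro t ht x
    have h0 : forceDuhamel ν 0 (0 : ℝ → EuclideanSpace ℝ (Fin 3) → EuclideanSpace ℝ (Fin 3)) t x = 0 := by
      rw [forceDuhamel_apply]
      have hz : ∀ τ, UnboundedOperators.heatExtension
          ((0 : ℝ → EuclideanSpace ℝ (Fin 3) → EuclideanSpace ℝ (Fin 3)) τ) (ν * (t - τ)) x = 0 := by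
        intro τ
        have : ((0 : ℝ → EuclideanSpace ℝ (Fin 3) → EuclideanSpace ℝ (Fin 3)) τ) =
            fun _ : EuclideanSpace ℝ (Fin 3) => (0 : EuclideanSpace ℝ (Fin 3)) := rfl
        rw [this, UnboundedOperators.heatExtension_zero_fun]; rfl
      simp_rw [hz, integral_zero]
    rw [h0, sub_zero]
    refine (norm_forceDuhamel_le_of_eLpNorm_two hν ht.1 hG₂r
      (fun τ hτ => hg'memT τ ⟨hτ.1.le, hτ.2.le.trans ht.2⟩)
      (fun τ hτ => hg'2T τ ⟨hτ.1.le, hτ.2.le.trans ht.2⟩) x).trans ?_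
    have ht4 : t ^ (1 / 4 : ℝ) ≤ (T - s) ^ (1 / 4 : ℝ) := Real.rpow_le_rpow ht.1.le ht.2 (by norm_num)
    have hν34 : 0 ≤ 4 * ν ^ (-(3 / 4 : ℝ)) := by positivity
    gcongr

end Sharp

end Literature.Analysis.FluidPDE

end
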